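import Summits.Ventures.Crystal3D.Theorems.StickyWulffConstantCoaxialWallLawReaderRigidity
import Summits.Ventures.Crystal3D.Theorems.StickyWulffConstantCoaxialWallLawTwinCageLocal
import HarnessLib

/-!
# Reader rigidity II: two ADJACENT twin readers share a lattice
# (crux `CoaxialWallLaw`, stmt-Ventures-19481, line `WallLedgerF`; census-free brick for the OFF-MODULE tail)

HONEST FRAMING. Venture `Summits/Ventures/Crystal3D` (cell `crystal3d-full`), helper `--supports` the crux
`CoaxialWallLaw` (stmt-Ventures-19481, `route-Ventures-StickyWulffConstant`), REGISTERED line `WallLedgerF` (planner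
cf-p1, (lxxiv)(4): structure of the reader complex).  Rung credit; F-C1 not moved; census-free.  Sequel of
`…CoaxialWallLawReaderRigidity` (FULL/FULL and FULL/TWIN).  A TWIN READER `q` for `(G, m)` (`IsTwinReading X G m q`)
carries TWO lattices: `G·Λ₀` (its closed lower half) and the mirror twin `(R_m G)·Λ₀` (`R_m G = G.trans ((ℝ ∙ m)ᗮ.reflection)`;
its in-plane hexagon and its three mirrors).

* table facts `twin_lower_triangle_tab`, `twin_inplane_triangle_tab` (decide) and their geometric forms
  `exists_lower_slot_triangle` (a slot reading `≤ 0` against a menu normal lies in a slot triangle reading `≤ 0`),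
  `exists_inplane_slot_triangle` (a negative slot lies in a slot triangle whose other two slots are in-plane);
* `exists_twin_member_triangle` — every member `d` of a twin dozen lies in a triangle of members `{d, t₁, t₂}` contained in
  ONE of the two lattices;
* **`movedFcc_eq_of_isTwinReading_adjacent`** — in a `1`-separated `X`, two twin readers `q₁` (for `(G₁, m₁)`) and `q₂` (for
  `(G₂, m₂)`) at distance `1` have a COMMON lattice: one of `G₁·Λ₀, (R_{m₁} G₁)·Λ₀` equals one of `G₂·Λ₀, (R_{m₂} G₂)·Λ₀`.
With `…ReaderRigidity`: along any chain of touching FULL/TWIN readers consecutive readers share a lattice, so a contact-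
connected reader cluster is a chain of coaxial (lattice-or-twin) steps; non-coaxially related readers never touch.
WHAT THIS IS NOT: not the tail; F-C1 not moved.
-/

noncomputable section

namespace Summit.Ventures.Crystal3D.Theorems

open Summit.Ventures.Crystal3D Finset NearIdentity
open Literature.MathematicalPhysics.StatisticalMechanics (fccStacking constHagg)
open Literature.Barriers.AtomisticToContinuum (barlowAddSubgroupOfConst)
open scoped InnerProductSpace

/-! ### Table facts -/

/-- A slot reading `≤ 0` against a cube diagonal lies in a slot triangle all of whose slots read `≤ 0`. -/
theorem twin_lower_triangle_tab : ∀ c : Fin 8, ∀ k : Fin 12, sdot3 (slotInt k) (cubeInt c) ≤ 0 →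
    ∃ l₁ l₂ : Fin 12, slotInt k ⬝ᵥ slotInt l₁ = 1 ∧ slotInt k ⬝ᵥ slotInt l₂ = 1 ∧ slotInt l₁ ⬝ᵥ slotInt l₂ = 1 ∧
      sdot3 (slotInt l₁) (cubeInt c) ≤ 0 ∧ sdot3 (slotInt l₂) (cubeInt c) ≤ 0 := by
  decide

/-- A negative slot lies in a slot triangle whose other two slots are in-plane. -/
theorem twin_inplane_triangle_tab : ∀ c : Fin 8, ∀ k : Fin 12, sdot3 (slotInt k) (cubeInt c) = -2 →
    ∃ l₁ l₂ : Fin 12, slotInt k ⬝ᵥ slotInt l₁ = 1 ∧ slotInt k ⬝ᵥ slotInt l₂ = 1 ∧ slotInt l₁ ⬝ᵥ slotInt l₂ = 1 ∧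
      sdot3 (slotInt l₁) (cubeInt c) = 0 ∧ sdot3 (slotInt l₂) (cubeInt c) = 0 := by
  decide

/-! ### Geometric triangles -/

section Geometry

variable (G : EuclideanSpace ℝ (Fin 3) ≃ₗᵢ[ℝ] EuclideanSpace ℝ (Fin 3)) {m : EuclideanSpace ℝ (Fin 3)}

/-- Adjacency of slots from the table. -/
theorem inner_slotSite_eq_half_of_dot {k l : Fin 12} (h : slotInt k ⬝ᵥ slotInt l = 1) :
    ⟪slotSite k, slotSite l⟫_ℝ = 1 / 2 := by
  rw [inner_slotSite, h]; norm_num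

/-- **A slot reading `≤ 0` lies in a slot triangle reading `≤ 0`.** -/
theorem exists_lower_slot_triangle (hm : IsMenuNormal G m) {w : EuclideanSpace ℝ (Fin 3)} (hw : w ∈ fccSlots)
    (hle : ⟪G w, m⟫_ℝ ≤ 0) :
    ∃ u₁ ∈ fccSlots, ∃ u₂ ∈ fccSlots, ⟪w, u₁⟫_ℝ = 1 / 2 ∧ ⟪w, u₂⟫_ℝ = 1 / 2 ∧ ⟪u₁, u₂⟫_ℝ = 1 / 2 ∧
      ⟪G u₁, m⟫_ℝ ≤ 0 ∧ ⟪G u₂, m⟫_ℝ ≤ 0 := by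
  obtain ⟨c, hc⟩ := exists_cubeInt_of_menu_normal G hm.1 hm.2
  obtain ⟨k, rfl⟩ := exists_slotSite_eq hw
  obtain ⟨l₁, l₂, h1, h2, h12, s1, s2⟩ := twin_lower_triangle_tab c k ((twin_sgn_mem G hc k).1.1 hle)
  exact ⟨slotSite l₁, slotSite_mem l₁, slotSite l₂, slotSite_mem l₂, inner_slotSite_eq_half_of_dot h1,
    inner_slotSite_eq_half_of_dot h2, inner_slotSite_eq_half_of_dot h12, (twin_sgn_mem G hc l₁).1.2 s1,
    (twin_sgn_mem G hc l₂).1.2 s2⟩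

/-- **A negative slot lies in a slot triangle whose other two slots are in-plane.** -/
theorem exists_inplane_slot_triangle (hm : IsMenuNormal G m) {w : EuclideanSpace ℝ (Fin 3)} (hw : w ∈ fccSlots)
    (hlt : ⟪G w, m⟫_ℝ < 0) :
    ∃ u₁ ∈ fccSlots, ∃ u₂ ∈ fccSlots, ⟪w, u₁⟫_ℝ = 1 / 2 ∧ ⟪w, u₂⟫_ℝ = 1 / 2 ∧ ⟪u₁, u₂⟫_ℝ = 1 / 2 ∧
      ⟪G u₁, m⟫_ℝ = 0 ∧ ⟪G u₂, m⟫_ℝ = 0 := by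
  obtain ⟨c, hc⟩ := exists_cubeInt_of_menu_normal G hm.1 hm.2
  obtain ⟨k, rfl⟩ := exists_slotSite_eq hw
  obtain ⟨l₁, l₂, h1, h2, h12, s1, s2⟩ := twin_inplane_triangle_tab c k ((twin_sgn_mem G hc k).2.1.1 hlt)
  refine ⟨slotSite l₁, slotSite_mem l₁, slotSite l₂, slotSite_mem l₂, inner_slotSite_eq_half_of_dot h1,
    inner_slotSite_eq_half_of_dot h2, inner_slotSite_eq_half_of_dot h12, ?_, ?_⟩
  · rw [inner_map_slotSite_menu hc l₁, s1]; simp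
  · rw [inner_map_slotSite_menu hc l₂, s2]; simp

end Geometry

/-! ### Moved lattices are closed under differences -/

/-- `A·Λ₀` is closed under subtraction. -/
theorem sub_mem_movedFcc (A : EuclideanSpace ℝ (Fin 3) ≃ₗᵢ[ℝ] EuclideanSpace ℝ (Fin 3)) {x y : EuclideanSpace ℝ (Fin 3)}
    (hx : x ∈ A '' fccStacking 1 (Real.sqrt (2 / 3))) (hy : y ∈ A '' fccStacking 1 (Real.sqrt (2 / 3))) :
    x - y ∈ A '' fccStacking 1 (Real.sqrt (2 / 3)) := by
  obtain ⟨a, ha, rfl⟩ := hx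
  obtain ⟨b, hb, rfl⟩ := hy
  set Λ : AddSubgroup (EuclideanSpace ℝ (Fin 3)) :=
    barlowAddSubgroupOfConst 1 (Real.sqrt (2 / 3)) constHagg (fun _ => rfl) with hΛ
  have hmem : ∀ w, w ∈ Λ ↔ w ∈ fccStacking 1 (Real.sqrt (2 / 3)) := fun w => Iff.rfl
  exact ⟨a - b, (hmem _).1 (Λ.sub_mem ((hmem _).2 ha) ((hmem _).2 hb)), by rw [map_sub]⟩

/-- `A·Λ₀` is closed under negation. -/
theorem neg_mem_movedFcc (A : EuclideanSpace ℝ (Fin 3) ≃ₗᵢ[ℝ] EuclideanSpace ℝ (Fin 3)) {x : EuclideanSpace ℝ (Fin 3)}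
    (hx : x ∈ A '' fccStacking 1 (Real.sqrt (2 / 3))) : -x ∈ A '' fccStacking 1 (Real.sqrt (2 / 3)) := by
  obtain ⟨a, ha, rfl⟩ := hx
  exact ⟨-a, fcc_neg_mem ha, by rw [map_neg]⟩

/-- Three unit vectors of a moved lattice pairwise at `60°` are linearly independent. -/
theorem linearIndependent_of_movedFcc_pairwise_half (A : EuclideanSpace ℝ (Fin 3) ≃ₗᵢ[ℝ] EuclideanSpace ℝ (Fin 3))
    {a b c : EuclideanSpace ℝ (Fin 3)} (ha : a ∈ A '' fccStacking 1 (Real.sqrt (2 / 3)))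
    (hb : b ∈ A '' fccStacking 1 (Real.sqrt (2 / 3))) (hc : c ∈ A '' fccStacking 1 (Real.sqrt (2 / 3)))
    (na : ‖a‖ = 1) (nb : ‖b‖ = 1) (nc : ‖c‖ = 1) (hab : ⟪a, b⟫_ℝ = 1 / 2) (hac : ⟪a, c⟫_ℝ = 1 / 2)
    (hbc : ⟪b, c⟫_ℝ = 1 / 2) : LinearIndependent ℝ ![a, b, c] := by
  obtain ⟨a', ha', rfl⟩ := ha
  obtain ⟨b', hb', rfl⟩ := hb
  obtain ⟨c', hc', rfl⟩ := hc
  rw [LinearIsometryEquiv.norm_map] at na nb nc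
  rw [LinearIsometryEquiv.inner_map_map] at hab hac hbc
  exact linearIndependent_map_triple A
    (linearIndependent_of_pairwise_half (mem_fccSlots_of_unit ha' na) (mem_fccSlots_of_unit hb' nb)
      (mem_fccSlots_of_unit hc' nc) hab hac hbc)

/-! ### Member triangles and the twin–twin rule -/

section Twin

variable {X : Finset (EuclideanSpace ℝ (Fin 3))} (hX : ∀ p ∈ X, ∀ q ∈ X, p ≠ q → 1 ≤ dist p q)

/-- **Member triangle.**  For a twin reader `q` (frame `G`, normal `m`) and a contact `q + d ∈ X` (`‖d‖ = 1`), there are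
two further contacts `q + t₁, q + t₂ ∈ X` with `d, t₁, t₂` pairwise at `60°`, all three on ONE of the lattices `G·Λ₀`,
`(R_m G)·Λ₀`. -/
theorem exists_twin_member_triangle {G : EuclideanSpace ℝ (Fin 3) ≃ₗᵢ[ℝ] EuclideanSpace ℝ (Fin 3)}
    {m q d : EuclideanSpace ℝ (Fin 3)} (h : IsTwinReading X G m q) (hdn : ‖d‖ = 1) (hd : q + d ∈ X)
    (hX : ∀ p ∈ X, ∀ q ∈ X, p ≠ q → 1 ≤ dist p q) :
    ∃ A : EuclideanSpace ℝ (Fin 3) ≃ₗᵢ[ℝ] EuclideanSpace ℝ (Fin 3), (A = G ∨ A = G.trans (ℝ ∙ m)ᗮ.reflection) ∧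
      ∃ t₁ t₂ : EuclideanSpace ℝ (Fin 3), q + t₁ ∈ X ∧ q + t₂ ∈ X ∧ ‖t₁‖ = 1 ∧ ‖t₂‖ = 1 ∧
        ⟪d, t₁⟫_ℝ = 1 / 2 ∧ ⟪d, t₂⟫_ℝ = 1 / 2 ∧ ⟪t₁, t₂⟫_ℝ = 1 / 2 ∧
        d ∈ A '' fccStacking 1 (Real.sqrt (2 / 3)) ∧ t₁ ∈ A '' fccStacking 1 (Real.sqrt (2 / 3)) ∧
        t₂ ∈ A '' fccStacking 1 (Real.sqrt (2 / 3)) := by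
  have hm : IsMenuNormal G m := h.1
  have hlow : ∀ w ∈ fccSlots, ⟪G w, m⟫_ℝ ≤ 0 → q + G w ∈ X := h.2.1
  have hm1 : ‖m‖ = 1 := hm.1
  have hrefl : ∀ w, (G.trans (ℝ ∙ m)ᗮ.reflection) w = G w - (2 * ⟪G w, m⟫_ℝ) • m := fun w => by
    rw [LinearIsometryEquiv.trans_apply, reflection_unit_apply hm1]
  rcases mem_twinDozen_of_contact_of_isTwinReading hX h hd (by rw [dist_eq_norm]; simpa using hdn) with
    ⟨w, hw, hle, he⟩ | ⟨w, hw, hlt, he⟩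
  · -- slot member (in-plane or negative): a lower triangle in `G·Λ₀`
    have hdw : d = G w := add_left_cancel he
    obtain ⟨u₁, hu₁, u₂, hu₂, i1, i2, i12, s1, s2⟩ := exists_lower_slot_triangle G hm hw hle
    refine ⟨G, Or.inl rfl, G u₁, G u₂, hlow u₁ hu₁ s1, hlow u₂ hu₂ s2, ?_, ?_, ?_, ?_, ?_, ?_, ?_, ?_⟩
    · rw [LinearIsometryEquiv.norm_map, norm_eq_one_of_mem_fccSlots hu₁]
    · rw [LinearIsometryEquiv.norm_map, norm_eq_one_of_mem_fccSlots hu₂]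
    · rw [hdw, LinearIsometryEquiv.inner_map_map, i1]
    · rw [hdw, LinearIsometryEquiv.inner_map_map, i2]
    · rw [LinearIsometryEquiv.inner_map_map, i12]
    · exact ⟨w, mem_fcc_of_mem_fccSlots hw, hdw.symm⟩
    · exact ⟨u₁, mem_fcc_of_mem_fccSlots hu₁, rfl⟩
    · exact ⟨u₂, mem_fcc_of_mem_fccSlots hu₂, rfl⟩
  · -- mirror member: an in-plane triangle, read in `(R_m G)·Λ₀`
    have hdw : d = G w - (2 * ⟪G w, m⟫_ℝ) • m := add_left_cancel he
    obtain ⟨u₁, hu₁, u₂, hu₂, i1, i2, i12, z1, z2⟩ := exists_inplane_slot_triangle G hm hw hlt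
    have e1 : (G.trans (ℝ ∙ m)ᗮ.reflection) u₁ = G u₁ := by rw [hrefl, z1]; simp
    have e2 : (G.trans (ℝ ∙ m)ᗮ.reflection) u₂ = G u₂ := by rw [hrefl, z2]; simp
    have ed : (G.trans (ℝ ∙ m)ᗮ.reflection) w = d := by rw [hrefl, hdw]
    refine ⟨G.trans (ℝ ∙ m)ᗮ.reflection, Or.inr rfl, G u₁, G u₂, hlow u₁ hu₁ z1.le, hlow u₂ hu₂ z2.le,
      ?_, ?_, ?_, ?_, ?_, ?_, ?_, ?_⟩
    · rw [LinearIsometryEquiv.norm_map, norm_eq_one_of_mem_fccSlots hu₁]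
    · rw [LinearIsometryEquiv.norm_map, norm_eq_one_of_mem_fccSlots hu₂]
    · rw [← ed, ← e1, LinearIsometryEquiv.inner_map_map, i1]
    · rw [← ed, ← e2, LinearIsometryEquiv.inner_map_map, i2]
    · rw [LinearIsometryEquiv.inner_map_map, i12]
    · exact ⟨w, mem_fcc_of_mem_fccSlots hw, ed⟩
    · exact ⟨u₁, mem_fcc_of_mem_fccSlots hu₁, e1⟩
    · exact ⟨u₂, mem_fcc_of_mem_fccSlots hu₂, e2⟩

include hX in
/-- **TWO ADJACENT TWIN READERS SHARE A LATTICE.**  In a `1`-separated `X`, if `q₁ ∈ X` is a twin reader for `(G₁, m₁)`,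
`q₂ ∈ X` a twin reader for `(G₂, m₂)`, and `dist q₁ q₂ = 1`, then one of `G₁·Λ₀, (R_{m₁} G₁)·Λ₀` equals one of
`G₂·Λ₀, (R_{m₂} G₂)·Λ₀`. -/
theorem movedFcc_eq_of_isTwinReading_adjacent
    {G₁ G₂ : EuclideanSpace ℝ (Fin 3) ≃ₗᵢ[ℝ] EuclideanSpace ℝ (Fin 3)} {m₁ m₂ q₁ q₂ : EuclideanSpace ℝ (Fin 3)}
    (hq₁ : q₁ ∈ X) (hq₂ : q₂ ∈ X) (h₁ : IsTwinReading X G₁ m₁ q₁) (h₂ : IsTwinReading X G₂ m₂ q₂)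
    (hd : dist q₁ q₂ = 1) :
    ∃ A B : EuclideanSpace ℝ (Fin 3) ≃ₗᵢ[ℝ] EuclideanSpace ℝ (Fin 3),
      (A = G₁ ∨ A = G₁.trans (ℝ ∙ m₁)ᗮ.reflection) ∧ (B = G₂ ∨ B = G₂.trans (ℝ ∙ m₂)ᗮ.reflection) ∧
      A '' fccStacking 1 (Real.sqrt (2 / 3)) = B '' fccStacking 1 (Real.sqrt (2 / 3)) := by
  -- the bond `d = q₂ − q₁` and a member triangle at it, on a lattice `A` of `q₁`
  set d := q₂ - q₁ with hdd
  clear_value d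
  have hdn : ‖d‖ = 1 := by rw [hdd, ← dist_eq_norm, dist_comm, hd]
  have hqd : q₁ + d = q₂ := by rw [hdd]; abel
  obtain ⟨A, hA, t₁, t₂, ht₁, ht₂, n1, n2, i01, i02, i12, mA0, mA1, mA2⟩ :=
    exists_twin_member_triangle (X := X) h₁ hdn (by rw [hqd]; exact hq₂) hX
  -- the three contacts of `q₂`: `−d`, `t₁ − d`, `t₂ − d`
  have c0 : q₂ + -d ∈ X := by rw [← hqd]; simpa using hq₁
  have c1 : q₂ + (t₁ - d) ∈ X := by rw [← hqd, show q₁ + d + (t₁ - d) = q₁ + t₁ by abel]; exact ht₁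
  have c2 : q₂ + (t₂ - d) ∈ X := by rw [← hqd, show q₁ + d + (t₂ - d) = q₁ + t₂ by abel]; exact ht₂
  have hd1 : ⟪d, d⟫_ℝ = 1 := by rw [real_inner_self_eq_norm_sq, hdn, one_pow]
  have ht11 : ⟪t₁, t₁⟫_ℝ = 1 := by rw [real_inner_self_eq_norm_sq, n1, one_pow]
  have ht22 : ⟪t₂, t₂⟫_ℝ = 1 := by rw [real_inner_self_eq_norm_sq, n2, one_pow]
  have m0 : ‖-d‖ = 1 := by rw [norm_neg, hdn]
  have m1 : ‖t₁ - d‖ = 1 := by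
    have : ‖t₁ - d‖ ^ 2 = 1 := by rw [norm_sub_sq_real, n1, hdn, real_inner_comm, i01]; norm_num
    nlinarith [norm_nonneg (t₁ - d)]
  have m2 : ‖t₂ - d‖ = 1 := by
    have : ‖t₂ - d‖ ^ 2 = 1 := by rw [norm_sub_sq_real, n2, hdn, real_inner_comm, i02]; norm_num
    nlinarith [norm_nonneg (t₂ - d)]
  have j01 : ⟪-d, t₁ - d⟫_ℝ = 1 / 2 := by rw [inner_neg_left, inner_sub_right, i01, hd1]; norm_num
  have j02 : ⟪-d, t₂ - d⟫_ℝ = 1 / 2 := by rw [inner_neg_left, inner_sub_right, i02, hd1]; norm_num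
  have j12 : ⟪t₁ - d, t₂ - d⟫_ℝ = 1 / 2 := by
    have e : ⟪t₁, d⟫_ℝ = 1 / 2 := by rw [real_inner_comm]; exact i01
    rw [inner_sub_left, inner_sub_right, inner_sub_right, i12, hd1, e, i02]; norm_num
  have a0 : -d ∈ A '' fccStacking 1 (Real.sqrt (2 / 3)) := neg_mem_movedFcc A mA0
  have a1 : t₁ - d ∈ A '' fccStacking 1 (Real.sqrt (2 / 3)) := sub_mem_movedFcc A mA1 mA0
  have a2 : t₂ - d ∈ A '' fccStacking 1 (Real.sqrt (2 / 3)) := sub_mem_movedFcc A mA2 mA0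
  have hind : LinearIndependent ℝ ![-d, t₁ - d, t₂ - d] :=
    linearIndependent_of_movedFcc_pairwise_half A a0 a1 a2 m0 m1 m2 j01 j02 j12
  -- trichotomy on the side of `q₂`
  have t0 := twin_contact_trichotomy hX h₂ m0 c0
  have t1 := twin_contact_trichotomy hX h₂ m1 c1
  have t2 := twin_contact_trichotomy hX h₂ m2 c2
  have K : ∀ {v v' : EuclideanSpace ℝ (Fin 3)}, ⟪v, v'⟫_ℝ = 1 / 2 →
      (∃ w ∈ fccSlots, ⟪G₂ w, m₂⟫_ℝ < 0 ∧ v = G₂ w) →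
      (∃ w ∈ fccSlots, ⟪G₂ w, m₂⟫_ℝ < 0 ∧ v' = G₂ w - (2 * ⟪G₂ w, m₂⟫_ℝ) • m₂) → False := by
    rintro v v' hin ⟨a, ha, hna, rfl⟩ ⟨a', ha', hna', rfl⟩
    exact inner_ne_half_of_neg_of_mirror h₂.1 ha ha' hna hna' hin
  have K' : ∀ {v v' : EuclideanSpace ℝ (Fin 3)}, ⟪v, v'⟫_ℝ = 1 / 2 →
      (∃ w ∈ fccSlots, ⟪G₂ w, m₂⟫_ℝ < 0 ∧ v' = G₂ w) →
      (∃ w ∈ fccSlots, ⟪G₂ w, m₂⟫_ℝ < 0 ∧ v = G₂ w - (2 * ⟪G₂ w, m₂⟫_ℝ) • m₂) → False := by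
    intro v v' hin hN hM
    exact K (by rw [real_inner_comm]; exact hin) hN hM
  set Λ₂ := G₂ '' fccStacking 1 (Real.sqrt (2 / 3))
  set Λ₂' := (G₂.trans (ℝ ∙ m₂)ᗮ.reflection) '' fccStacking 1 (Real.sqrt (2 / 3))
  have key : (-d ∈ Λ₂ ∧ t₁ - d ∈ Λ₂ ∧ t₂ - d ∈ Λ₂) ∨ (-d ∈ Λ₂' ∧ t₁ - d ∈ Λ₂' ∧ t₂ - d ∈ Λ₂') := by
    rcases t0 with ⟨p0, q0⟩ | ⟨p0, N0⟩ | ⟨q0, M0⟩ <;>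
    rcases t1 with ⟨p1, q1⟩ | ⟨p1, N1⟩ | ⟨q1, M1⟩ <;>
    rcases t2 with ⟨p2, q2⟩ | ⟨p2, N2⟩ | ⟨q2, M2⟩
    all_goals first
      | exact Or.inl ⟨p0, p1, p2⟩
      | exact Or.inr ⟨q0, q1, q2⟩
      | exact (K j01 N0 M1).elim | exact (K' j01 N1 M0).elim
      | exact (K j02 N0 M2).elim | exact (K' j02 N2 M0).elim
      | exact (K j12 N1 M2).elim | exact (K' j12 N2 M1).elim
  rcases key with ⟨b0, b1, b2⟩ | ⟨b0, b1, b2⟩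
  · exact ⟨A, G₂, hA, Or.inl rfl, movedFcc_eq_of_three_independent_units A G₂ a0 a1 a2 b0 b1 b2 m0 m1 m2 hind⟩
  · exact ⟨A, _, hA, Or.inr rfl, movedFcc_eq_of_three_independent_units A _ a0 a1 a2 b0 b1 b2 m0 m1 m2 hind⟩

end Twin

end Summit.Ventures.Crystal3D.Theorems

end
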